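import Summits.BirchSwinnertonDyer.Rank1Residual.X11b.BDPRouteOpenInputHalves
import HarnessLib

/-!
# Class X11b, route p2 at `p ≥ 5`: THE OPEN INPUT IN FRAME FORM (∃∧-currency) — per datum ONE BDP
# frame carrying Cas18 Thm. 3.1's interpolation ∧ Thm. 3.2's value at `𝟙` ∧ the erratum's divisibility
# (2.4); the dischargeable currency of a refereed statement about Castella's own `L_p(f)`
# (cell `b2b-bsdres`, sub-cell `multr1-p2`, gen 23)

HONEST FRAMING (cell `b2b-bsdres`, run/shared/lean/b2b/bsd-rank1-residual/, verbatim in every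
file): the goal of the cell is to DELETE the COMBINATION-SHAPED residual classes of the
Birch–Swinnerton-Dyer formula for ALL analytic-rank `≤ 1` elliptic curves over `ℚ` — "full BSD
formula for every rank `≤ 1` curve in class `C`" assembled STRICTLY from published theorems — so
that the rank-`≤ 1` remainder becomes exactly the CONSTRUCTION-SHAPED classes, which are TYPED
(missing-input `Prop`s), NOT attempted. This is not "finishing BSD". Sub-cell `multr1-p2` is a
RESEARCH ROUTE on class X11b (`ClassX11b W p := r_an = 1 ∧ p ≠ 2 ∧ mult(p) ∧ irr(p)`,
`Partition/Rows.lean`); no claim beyond the stated class and loci; X11b's label does not change;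
NOTHING is booked by this file.

ONE `Prop`-valued class-level SHAPE with a body (`P2.IMCDivFrameOnTree`, OPEN, conjecture-tagged
since gen 29 — claim-tagged in gens 23–28, see SCOPE below —, never a theorem in this cell) and
theorems; no named fact; no `sorry`. Every result using the shape is CONDITIONAL.

SCOPE OF THE ANNOUNCED DERIVATION (gen 29, doc + tag only; statements byte-identical; sources re-read
verbatim). The shape is asked at CLASSICAL Heegner data (`SatisfiesHeegnerHypothesis`: every `ℓ ∣ N_E`
split in `K`). The derivation its gen-23 docstring pointed at for the divisibility conjunct, the
erratum's "(2.4) … By [FW21, Thm. 4.41]", carries Fouquet–Wan's hypothesis "there exists `q ∥ N` (in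
particular `q ∤ p`) which is not split in `K`" (arXiv:2107.13726v3, Thm. 4.41, third hypothesis; the
full inclusion moreover wants every non-split `ℓ ∣ N` RAMIFIED in `K`, `π(f)_ℓ` special Steinberg
twisted by the unramified quadratic character), exactly as [Castella2018, p. 4] ("at least one prime
`q ∣ N` nonsplit in `K`") and [Castella2024, Thm. 3.1 (iii)] do; classical Heegner data EXCLUDE such a
`q`. So that derivation lives at route R1's ERRATUM fields and is typed there
(`P2.IMCDivIntFrameAtErratumData`, `X11b/BDPRouteErratumData.lean`, gen 28); at classical Heegner
fields the published result in this direction is [BurungaleCastellaSkinner2025, Thm. 1.2.4]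
(`ch(X_Gr) = (L_p^BDP)`, primes `p > 3` of GOOD ORDINARY reduction), whose multiplicative analogue
(`p ∥ N`) is in no source the cell holds, and the only printed statement in this direction at `p ∥ N`
is STEP L itself ([SkinnerZhang2014] Thm. 1.2, PREPRINT; `indexLowerBoundAt_of_skinnerZhang_OPEN`).
Hence: NO announced derivation of the divisibility conjunct at these data (the frame and value
conjuncts keep their printed status: Cas18 Thms. 3.1–3.2 on semistable pairs, [Castella2024] PREPRINT
beyond); the shape is re-badged `@[conjecture]` (an instance of the Iwasawa–Greenberg main conjecture
for `X_ac(E[p^∞])`, [Castella2018, §1 (1.b)], with the frame and value clauses); every record using it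
was and stays CONDITIONAL on it; nothing else changes.

## Why a third currency

Route p2's open input now exists in three currencies: (i) the COMPOSITE `P2OpenInputOnTreeAt` (gen 11:
`2·(ord_p log P − 1) ≤ ord_p f_ac(0)`); (ii) the HALVES (gen 23, `BDPRouteOpenInputHalves.lean`):
(H1∧H2) `P2.BDPValueOnTree` [PUB shape] + (2.4) `P2.IMCDivOnTree` [OPEN], the latter in ∀-FRAME
currency — divisibility at EVERY `(Ω_K, Ω_p, L)` with `IsBDPLFunction` (multr1-p1's hand-over
p258094). As multr1-p1 GEN 22 points out (INBOX 09:45Z/09:47Z; `RouteR1IMCEqFrame.lean`,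
`BDPFrameUniqueness.lean`), a refereed statement about Castella's OWN `L_p(f)` is ONE frame in the
registry's ∃∧ currency and does not discharge a ∀-frame shape (across different periods the ∀-frame
statement is genuinely stronger; at fixed periods the two agree only under a supply-of-characters
hypothesis). Hence (iii), this file: **`P2.IMCDivFrameOnTree W p`** — per datum THERE IS a frame with
Thm. 3.1's interpolation property ∧ Thm. 3.2's value at `𝟙` ∧ (2.4) for THAT frame; the `⊆` twin of
multr1-p1's `R1.IMCEqFrameOnTree`. Implications proved here: halves ⟹ frame form (any pair);
`h32` + (2.4)∀ ⟹ frame form (semistable pair); frame form ⟹ composite (any pair, via the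
one-sided control theorem). So the frame form is WEAKER than everything the route typed before, and it
is what a jointly-typed refereed fact (Cas18 3.1 ∧ 3.2 ∧ erratum (2.4) for the same `L_p(f)`) would
instantiate directly — on semistable AND non-semistable pairs ([Castella 2024, Thm. 3.1 with §2.3]
states all three for any `E` with multiplicative `p > 3`, PREPRINT; Cas18 §§2–3 stand under
"`E` semistable").

* §1 def **`P2.IMCDivFrameOnTree W p`** (OPEN shape, claim-tagged).
* §2 `P2.imcDivFrameOnTree_of_halves` ((H1∧H2) + (2.4)∀ ⟹ frame form),
  `P2.imcDivFrameOnTree_of_thm32_of_semistable` (`h32` + semistable + (2.4)∀ ⟹ frame form).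
* §3 **`P2.openInputOnTreeAt_of_imcDivFrame`** (ANY pair: `hnf hGZK hKo hPT hEP` + frame form ⟹
  `P2OpenInputOnTreeAt W p`), `…_of_controlUpper`, `P2.missingLowerBoundAt_of_imcDivFrame`,
  `P2.bsdp_of_locus_of_imcDivFrame` (ANY Locus pair, semistable or not: PUB + cited + the frame form at
  the pair — NOTHING per pair; 2 093 111 ‖ 61 629 pairs).
* §4 RECORD **`P2.bsdp_of_onTree_frame`**: `∀ (E,p) ∈` X11b, `p ≥ 5 → BSD(E,p)` from published + cited
  facts and ONE typed shape `P2.IMCDivFrameOnTree` on every pair (+ REG/TC per pair, the conjecture on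
  334 ‖ 35, the corner 64 ‖ 5) — NO `h32`, NO semistability case split.

CONDITIONAL on the frame form (open); deletes nothing; labels UNCHANGED; X11b stays CONSTRUCTION-SHAPED.

References: [Castella2018] §1 (1.b) (p. 3), p. 4, Thms. 2.3, 3.1, (3.2), 3.2, §5 (arXiv:1704.06608 pp.
5, 9, 12); [Castella2018Erratum] (2.4), Thm. 1.1 (pp. 1, 4); [Castella2024] arXiv:2409.01360 Thm. 3.1,
§2.3 (PREPRINT); [FouquetWan2021] Thm. 4.41 (arXiv:2107.13726v3 p. 44; PREPRINT);
[BurungaleCastellaSkinner2025] Thm. 1.2.4; [SkinnerZhang2014] Thm. 1.2 (PREPRINT); [CastellaHsieh2018]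
§3.3; [Miller2011LMS] Def. 1.1.
-/

noncomputable section

open scoped Classical NumberField

open WeierstrassCurve NumberField IsDedekindDomain Field PowerSeries
open Literature.NumberTheory.EllipticCurves Literature.NumberTheory.EllipticCurves.GreenbergSelmer
open Literature.NumberTheory.EllipticCurves.ModularForms
open Literature.NumberTheory.EllipticCurves.Rank1Residual
open Literature.NumberTheory.EllipticCurves.Rank1Residual.Typed
open Literature.NumberTheory.EllipticCurves.Wuthrich2014
open Literature.NumberTheory.EllipticCurves.Castella2018
open Literature.NumberTheory.EllipticCurves.SteinWuthrich2013
open Literature.NumberTheory.EllipticCurves.Disegni2020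
open Literature.NumberTheory.EllipticCurves.Skinner2016
open Literature.NumberTheory.EllipticCurves.BalakrishnanEtAl2019
open Literature.NumberTheory.QuadraticFields.Quadratic
open Literature.NumberTheory.GaloisRepresentations Literature.NumberTheory.GaloisCohomology
open Summit.BirchSwinnertonDyer.Rank1Residual.X11b.AcSelmer
open Summit.BirchSwinnertonDyer.Rank1Residual.X11b.Halves

namespace Summit.BirchSwinnertonDyer.Rank1Residual.X11b

/-! ### §1 The open input of route p2 in frame form (OPEN shape) -/

section Shape

variable (W : WeierstrassCurve ℚ) [W.IsElliptic] [W.IsGloballyMinimal] (p : ℕ) [Fact p.Prime]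

/-- **Route p2's open input in FRAME FORM — Cas18 Thm. 3.1 ∧ Thm. 3.2 ∧ erratum (2.4) for ONE frame,
per datum (OPEN shape, ∃∧-currency).** At every datum of `P2OpenInputOnTreeAt W p` (`(E,p)` in X11b,
`p ≥ 5`, `ρ̄_{E,p}` onto; `K` imaginary quadratic, `d_K` odd, `p ∤ d_K`, `p ∤ #𝓞_K^×`, every
`ℓ ∣ N_E` split, `L(E^{d_K},1) ≠ 0`; a parametrisation datum `Dt` of level `N_E` with `p ∤ c`; `P` its
Heegner point read through `ι`, non-torsion; anticyclotomic `(κ, γ)`), for every embedding datum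
`ι' : ℚ̄_p ≃ ℂ`, infinite place `w₀`, point `P'` read as `heegnerPointComplex Dt H` through `w₀`, and
`e : K → ℚ_p` inducing `𝔭_{ι'} = primeOfEmbeddingDatum p ι' w₀.embedding`: THERE IS a frame
`(Ω_K ≠ 0, Ω_p ∈ R₀ˣ, L ∈ R₀⟦T⟧)` with `IsBDPLFunction ι' 𝔭_{ι'} κ γ f_{Dt} Ω_K Ω_p L` [Thm. 3.1] ∧
`L(𝟙) = u·((1 − a_p(E) p⁻¹)·log_{ω_E} P')²`, `u ∈ R₀ˣ` [Thm. 3.2; `R1.BDPValueAtOneOnTreeAt`] ∧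
`Ch_Λ(X_ac^∅(E[p^∞]))·R₀⟦T⟧ ⊆ (L)` for the constructed `X_ac` at `𝔭_{ι'}` [the erratum's display
(2.4) TRANSCRIBED to these classical data — NO announced derivation here: the erratum's "(2.4) ⇐
[FW21, Thm. 4.41]" needs a prime `q ∥ N` NOT split in `K`; the announced derivation is typed at
erratum data as `P2.IMCDivIntFrameAtErratumData` (file docstring, SCOPE, gen 29)]. The `⊆` twin of
multr1-p1's `R1.IMCEqFrameOnTree`; implied by the gen-23 halves (`P2.imcDivFrameOnTree_of_halves`).
Its divisibility conjunct is an instance of the Iwasawa–Greenberg main conjecture for `X_ac(E[p^∞])`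
at `p ∥ N` and classical Heegner fields — the multiplicative analogue of [BurungaleCastellaSkinner2025,
Thm. 1.2.4] (good ordinary `p`), not in print; a predicate on `(W, p)`; OPEN; NEVER a theorem in this
cell; every result using it is CONDITIONAL. (Gens 23–28 badged it as claimed-by-the-erratum —
withdrawn gen 29: the erratum does not state (2.4) at these data.)
[cite: Castella2018, §1 (1.b) (arXiv:1704.06608 p. 3) and Thm. 3.1, display (3.2), Thm. 3.2 (p. 9) (conjecture display, frame and value; shape only; nothing asserted)]
[cite: Castella2018Erratum, (2.4) (p. 4) (display transcribed; its derivation there assumes a prime of N non-split in K; nothing asserted)] -/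
@[conjecture]
def P2.IMCDivFrameOnTree : Prop :=
  ∀ (N : ℕ) [NeZero N] (K : Type) [Field K] [NumberField K]
    (Dt : ModularParametrizationData W N) (H : HeegnerDatum N (NumberField.discr K)) (ι : K →+* ℂ)
    (P : (W.baseChange K).toAffine.Point),
    ClassX11b W p → 5 ≤ p → Surj W p → W.conductorNorm ℤ = N → IsImaginaryQuadratic K →
    Odd (NumberField.discr K) → ¬ (p : ℤ) ∣ NumberField.discr K → ¬ p ∣ Units.torsionOrder K →
    SatisfiesHeegnerHypothesis N K →
    (W.quadraticTwist (NumberField.discr K : ℚ)).entireLFunction 1 ≠ 0 →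
    WeierstrassCurve.Affine.Point.map ι.toRatAlgHom P = heegnerPointComplex Dt H →
    ¬ (p : ℤ) ∣ Dt.c → ¬ IsOfFinAddOrder P →
    ∀ (κ : ZpExtension K p), κ.IsAnticyclotomic →
      ∀ (γ : Field.absoluteGaloisGroup K) [Fact (κ.IsTopGenerator γ)]
        (ι' : PadicAlgCl p ≃+* ℂ) (w₀ : InfinitePlace K) (P' : (W.baseChange K).toAffine.Point),
        WeierstrassCurve.Affine.Point.map w₀.embedding.toRatAlgHom P' = heegnerPointComplex Dt H →
        ∀ (e : K →+* ℚ_[p]),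
          (∀ k : 𝓞 K, k ∈ (primeOfEmbeddingDatum p ι' w₀.embedding).asIdeal ↔ ‖e (k : K)‖ < 1) →
          ∃ (ΩK : ℂ) (Ωp : (unrIntegers p)ˣ) (L : UnrSeries p), ΩK ≠ 0 ∧
            IsBDPLFunction ι' (primeOfEmbeddingDatum p ι' w₀.embedding) κ γ Dt.f ΩK
              ((Ωp : unrIntegers p) : ℂ_[p]) L ∧
            R1.BDPValueAtOneOnTreeAt W p e P' L (W.LFunction p) ∧
            (XAc.charIdeal (W.baseChange K) p κ (primeOfEmbeddingDatum p ι' w₀.embedding) ∅ γ).map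
              (PowerSeries.map (toUnr p)) ≤ Ideal.span {L}

end Shape

/-! ### §2 The frame form is implied by the halves, and by `h32` + (2.4)∀ on semistable pairs -/

section FromHalves

variable {W : WeierstrassCurve ℚ} [W.IsElliptic] [W.IsGloballyMinimal] {p : ℕ} [Fact p.Prime]

/-- **Halves ⟹ frame form** (any pair): (H1∧H2) `P2.BDPValueOnTree W p` supplies, at each
`(datum, κ, γ, ι', w₀, P', e)`, a frame with the interpolation property and the value at `𝟙`; the
∀-frame divisibility `P2.IMCDivOnTree W p` supplies (2.4) AT THAT frame. So the frame form is not
stronger than the gen-23 halves. [cite: Castella2018, Thms. 3.1–3.2 (arXiv:1704.06608 p. 9)]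
[cite: Castella2018Erratum, (2.4) (p. 4)] -/
theorem P2.imcDivFrameOnTree_of_halves (h2 : P2.BDPValueOnTree W p) (h3 : P2.IMCDivOnTree W p) :
    P2.IMCDivFrameOnTree W p := by
  intro N _ K _ _ Dt H ιK P hX h5 hs hN hK hodd hpd hμ hHN hLt hP hc hPinf κ hκ γ _ ι' w₀ P' hP' e he
  obtain ⟨ΩK, Ωp, L, hΩ, hL, hval⟩ :=
    h2 N K Dt H ιK P hX h5 hs hN hK hodd hpd hμ hHN hLt hP hc hPinf κ hκ γ ι' w₀ P' hP' e he
  exact ⟨ΩK, Ωp, L, hΩ, hL, hval,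
    h3 N K Dt H ιK P hX h5 hs hN hK hodd hpd hμ hHN hLt hP hc hPinf κ hκ γ Dt.f Dt.isNewformOf ι' w₀
      ΩK Ωp L hL⟩

/-- **`h32` + semistable + (2.4)∀ ⟹ frame form**: on a semistable pair the registered fact (Cas18
Thms. 3.1–3.2) gives (H1∧H2) (`P2.bdpValueOnTree_of_thm32_of_semistable`), whence the frame form by
`P2.imcDivFrameOnTree_of_halves`. [cite: Castella2018, Thms. 3.1–3.2 (arXiv:1704.06608 p. 9)]
[cite: Castella2018Erratum, (2.4) (p. 4)] -/
theorem P2.imcDivFrameOnTree_of_thm32_of_semistable (h32 : thm32_exists_isBDPLFunction_valueAtOne)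
    (hss : Semistable W) (h3 : P2.IMCDivOnTree W p) : P2.IMCDivFrameOnTree W p :=
  P2.imcDivFrameOnTree_of_halves (P2.bdpValueOnTree_of_thm32_of_semistable h32 hss) h3

end FromHalves

/-! ### §3 Route p2's open input from the frame form, on EVERY pair -/

section Composite

variable {W : WeierstrassCurve ℚ} [W.IsElliptic] [W.IsGloballyMinimal] {p : ℕ} [Fact p.Prime]

/-- **The composite open input from the frame form, with the one-sided control** (any pair): the proof
of `P2.openInputOnTreeAt_of_halves_of_controlUpper` run on the ONE frame the shape provides at
`(w₀, τ_* P, κ, γ, ι', embAt)` — value at `𝟙` and (2.4) for the same `L`, CTL₀ from the one-sided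
control, assembly by team x11b3's `Halves.imcLowerWaldspurgerOnTreeAt_of_value_of_dvd`, log-order
invariance under `τ`. CONDITIONAL on the frame form.
[cite: Castella2018, Thms. 2.3, 3.1, 3.2 and §5 (arXiv:1704.06608 pp. 5, 9, 12)]
[cite: Castella2018Erratum, (2.4) and Thm. 1.1 (pp. 1, 4)] -/
theorem P2.openInputOnTreeAt_of_imcDivFrame_of_controlUpper (hnf : exists_isNewformOf)
    (hGZK : rank_eq_analyticRank_of_analyticRank_le_one) (hC : P2ControlUpperOnTreeAt W p)
    (ι₀ : PadicAlgCl p ≃+* ℂ) (hF : P2.IMCDivFrameOnTree W p) : P2OpenInputOnTreeAt W p := by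
  intro N _ K _ _ Dt H ιK P hX h5 hs hN hK hodd hpd hμ hHN hLt hP hc hPinf κ hκ γ _ 𝔭 h𝔭 he hf
  obtain ⟨n, hn, -⟩ := hC N K Dt H ιK P hX h5 hs hN hK hodd hpd hμ hHN hLt hP hc hPinf κ hκ γ 𝔭 h𝔭 he hf
  have hF' := hF N K Dt H ιK P hX h5 hs hN hK hodd hpd hμ hHN hLt hP hc hPinf κ hκ γ
  subst hN
  obtain ⟨hr, -, -, -⟩ := hX
  obtain ⟨w₀⟩ := (inferInstance : Nonempty (InfinitePlace K))
  have hp2 : p ≠ 2 := by omega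
  -- `rank_ℤ E(K) = 1` (Gross–Zagier–Kolyvagin)
  have hrk : (W.baseChange K).mordellWeilRank = 1 :=
    mordellWeilRank_baseChange_eq_one_of_twist_ne_zero W hGZK hnf hr hK.1 hLt
  -- the datum's complex embedding is `w₀.embedding ∘ τ` for some `τ ∈ Gal(K/ℚ)`, `τ² = 1`
  haveI : IsGalois ℚ K := by
    haveI : Algebra.IsQuadraticExtension ℚ K := ⟨hK.1⟩
    infer_instance
  obtain ⟨σ, hσ⟩ := ComplexEmbedding.exists_comp_symm_eq_of_comp_eq (k := ℚ) w₀.embedding ιK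
    (by ext x; simp)
  set τ : K →+* K := ((σ.symm : K ≃ₐ[ℚ] K) : K →+* K) with hτdef
  have hτ : ∀ x, τ (τ x) = x := by
    intro x
    have hcard : Nat.card (K ≃ₐ[ℚ] K) = 2 := by rw [IsGalois.card_aut_eq_finrank, hK.1]
    have hsq : σ.symm * σ.symm = 1 := by
      have h := pow_card_eq_one' (G := K ≃ₐ[ℚ] K) (x := σ.symm)
      rwa [hcard, pow_two] at h
    have := congrArg (fun g : K ≃ₐ[ℚ] K ↦ g x) hsq
    simpa [hτdef, AlgEquiv.mul_apply] using this
  -- the Galois conjugate `P' = τ_* P` is the Heegner point read through `w₀.embedding`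
  set P' := WeierstrassCurve.Affine.Point.map τ.toRatAlgHom P with hP'def
  have hP' : WeierstrassCurve.Affine.Point.map w₀.embedding.toRatAlgHom P' =
      heegnerPointComplex Dt H := by
    rw [hP'def, WeierstrassCurve.Affine.Point.map_map]
    have hcomp : w₀.embedding.toRatAlgHom.comp τ.toRatAlgHom = ιK.toRatAlgHom := by
      apply AlgHom.ext
      intro x
      have := RingHom.congr_fun hσ x
      simpa [hτdef] using this
    rw [hcomp]
    exact hP
  have hlog : ∀ e : K →+* ℚ_[p], padicLogOrd W p e P' = padicLogOrd W p e P := fun e ↦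
    R1.padicLogOrd_map_eq_of_rank_one W p e P hp2 τ hτ hrk hPinf
  -- THE embedding at `𝔭` induces `𝔭`
  have hemb : ∀ k : 𝓞 K, k ∈ 𝔭.asIdeal ↔ ‖embAt K p 𝔭 h𝔭 he hf (k : K)‖ < 1 :=
    mem_asIdeal_iff_norm_embAt_lt_one 𝔭 h𝔭 he hf
  -- every degree-one prime above `p` is induced by `ι₀` or by `ι₀ ∘ conj`
  have key : ∀ ι' : PadicAlgCl p ≃+* ℂ, 𝔭 = primeOfEmbeddingDatum p ι' w₀.embedding →
      IMCLowerWaldspurgerOnTreeAt p κ 𝔭 γ (embAt K p 𝔭 h𝔭 he hf) P := by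
    intro ι' h𝔭eq
    subst h𝔭eq
    obtain ⟨ΩK, Ωp, L, -, -, ⟨u, hu⟩, hdiv⟩ := hF' ι' w₀ P' hP' (embAt K p _ h𝔭 he hf) hemb
    refine imcLowerWaldspurgerOnTreeAt_of_padicLogOrd_eq W p _ (hlog _) ?_
    exact imcLowerWaldspurgerOnTreeAt_of_value_of_dvd hn hdiv u (W.LFunction p) hu
  rcases eq_primeOfEmbeddingDatum_or_eq_trans_starRingAut p ι₀ hK w₀ h𝔭 with h | h
  · exact key ι₀ h
  · exact key _ h

/-- **ROUTE p2's OPEN INPUT FROM THE FRAME FORM, ON EVERY PAIR** — no semistability, no `h32`: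
`hnf` (modularity), `hGZK`, `hKo` (Kolyvagin), the CITED `hPT` (Poitou–Tate) and `hEP` (local Euler
characteristic) — through `p2ControlUpperOnTreeAt_of_facts` — and the ONE typed shape
`P2.IMCDivFrameOnTree W p`. CONDITIONAL on it. [cite: Castella2018, Thms. 2.3, 3.1, 3.2, §5 (arXiv:1704.06608 pp. 5, 9, 12)]
[cite: Castella2018Erratum, (2.4) (p. 4)] [cite: MilneADT2006, Ch. I, Thm. 4.10(b) and Thm. 2.8] -/
theorem P2.openInputOnTreeAt_of_imcDivFrame (hnf : exists_isNewformOf)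
    (hGZK : rank_eq_analyticRank_of_analyticRank_le_one)
    (hKo : ∀ (N : ℕ) [NeZero N] (W : WeierstrassCurve ℚ) (K : Type) [Field K] [NumberField K],
      kolyvagin N W K)
    (hPT : ∀ (K : Type) [Field K] [NumberField K], poitouTate_sum_localTatePairing_eq_zero K)
    (hEP : ∀ (K : Type) [Field K] [NumberField K] (v : HeightOneSpectrum (𝓞 K)),
      localEulerPoincareCharacteristic (v.adicCompletion K))
    (hF : P2.IMCDivFrameOnTree W p) : P2OpenInputOnTreeAt W p := by
  obtain ⟨ι₀⟩ := PadicAlgCl.nonempty_ringEquiv_complex p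
  exact P2.openInputOnTreeAt_of_imcDivFrame_of_controlUpper hnf hGZK
    (p2ControlUpperOnTreeAt_of_facts W p hKo hPT hEP) ι₀ hF

/-- **The main-conjecture half on ANY X11b ∧ surj pair at `p ≥ 5` from published + cited facts and
the frame form AT THE PAIR.** [cite: Castella2018Erratum, (2.4) (p. 4)] [cite: Castella2018, Thms. 2.3, 3.2]
[cite: JetchevSkinnerWan2017, §7.4.1 (pp. 30–31)] [cite: Wuthrich2014, Prop. 21 (p. 400)] [cite: Miller2011LMS, Def. 1.1] -/
theorem P2.missingLowerBoundAt_of_imcDivFrame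
    (hGZ : ∀ (N : ℕ) [NeZero N] (W : WeierstrassCurve ℚ) (K : Type) [Field K] [NumberField K],
      gross_zagier N W K)
    (hKo : ∀ (N : ℕ) [NeZero N] (W : WeierstrassCurve ℚ) (K : Type) [Field K] [NumberField K],
      kolyvagin N W K)
    (hWu : sha_dvd_analyticSha) (hGZK : rank_eq_analyticRank_of_analyticRank_le_one)
    (hnf : exists_isNewformOf) (hHL : HoffsteinLuo1997_exists_twist_L_one_ne_zero)
    (hMaz : mazur_not_dvd_maninConstant_of_odd)
    (hPT : ∀ (K : Type) [Field K] [NumberField K], poitouTate_sum_localTatePairing_eq_zero K)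
    (hEP : ∀ (K : Type) [Field K] [NumberField K] (v : HeightOneSpectrum (𝓞 K)),
      localEulerPoincareCharacteristic (v.adicCompletion K))
    (hF : P2.IMCDivFrameOnTree W p) (hX : ClassX11b W p) (hp5 : 5 ≤ p) (hsurj : Surj W p) :
    Typed.MissingLowerBoundAt W p :=
  P2.missingLowerBoundAt_of_openInputAt W p hGZ hKo hWu hGZK
    (hasEntireLFunction_rat_of_exists_isNewformOf hnf) hnf hHL hMaz hPT hEP
    (P2.openInputOnTreeAt_of_imcDivFrame hnf hGZK hKo hPT hEP hF) hX hp5 hsurj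

/-- **A1 — ANY Locus pair, semistable or not (2 093 111 ‖ 61 629): `BSD(E,p)` from published + cited
facts and the frame form AT THE PAIR — NOTHING per pair.** Gen 18's `P2.bsdp_of_locus_endState` with
the composite open input assembled from the frame form; the upper half is the THEOREM
`missingUpperBoundAt_of_classX11b_of_ram_of_not_dvd`. CONDITIONAL on the frame form; nothing booked.
[cite: Castella2018Erratum, (2.4), Thm. 1.1 (pp. 1, 4)] [cite: Castella2018, Thms. 3.1–3.2, §5]
[cite: Skinner2016PacificMC, Thm. C (§1)] [cite: McCallumLMS1991, §1 Theorem (Kolyvagin), p. 296]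
[cite: Miller2011LMS, Def. 1.1] -/
theorem P2.bsdp_of_locus_of_imcDivFrame
    (hGZ : ∀ (N : ℕ) [NeZero N] (W : WeierstrassCurve ℚ) (K : Type) [Field K] [NumberField K],
      gross_zagier N W K)
    (hKo : ∀ (N : ℕ) [NeZero N] (W : WeierstrassCurve ℚ) (K : Type) [Field K] [NumberField K],
      kolyvagin N W K)
    (hB : ∀ (N : ℕ) [NeZero N] (W : WeierstrassCurve ℚ) (K : Type) [Field K] [NumberField K],
      Kolyvagin1990_padicValNat_card_sha_le N W K)
    (hSk : Skinner2016.thmC_padicValRat_bsd_rank_zero) (hWu : sha_dvd_analyticSha)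
    (hGZK : rank_eq_analyticRank_of_analyticRank_le_one) (hnf : exists_isNewformOf)
    (hHL : HoffsteinLuo1997_exists_twist_L_one_ne_zero) (hMaz : mazur_not_dvd_maninConstant_of_odd)
    (hPT : ∀ (K : Type) [Field K] [NumberField K], poitouTate_sum_localTatePairing_eq_zero K)
    (hEP : ∀ (K : Type) [Field K] [NumberField K] (v : HeightOneSpectrum (𝓞 K)),
      localEulerPoincareCharacteristic (v.adicCompletion K))
    (hF : P2.IMCDivFrameOnTree W p)
    (hX : ClassX11b W p) (hp5 : 5 ≤ p) (hram : Ram W p) (htam : ¬ p ∣ W.tamagawaProduct) :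
    BSDp W p :=
  P2.bsdp_of_locus_endState W p hGZ hKo hB hSk hWu hGZK
    (hasEntireLFunction_rat_of_exists_isNewformOf hnf) hnf hHL hMaz hPT hEP
    (P2.openInputOnTreeAt_of_imcDivFrame hnf hGZK hKo hPT hEP hF) hX hp5 hram htam

end Composite

/-! ### §4 The class-level record over the frame form -/

/-- **Route p2 — STATEMENT OF RECORD OVER THE FRAME FORM (gen 23).** `∀ (E, p) ∈` X11b,
`p ≥ 5 → BSD(E, p)` from route p2's and the lever's published named facts (+ Kolyvagin 1990
Thm. A), the cited Poitou–Tate / local Euler characteristic, and the typed inputs: **the frame form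
`P2.IMCDivFrameOnTree` ON EVERY PAIR** — per datum ONE BDP frame with Cas18 Thm. 3.1's interpolation
∧ Thm. 3.2's value at `𝟙` ∧ the erratum's divisibility (2.4) (∃∧-currency; on semistable pairs its
first two conjuncts are the registered PUBLISHED fact and its open content is exactly (2.4) for
Castella's `L_p(f)` at CLASSICAL data — NO announced derivation, SCOPE in the file docstring; on
non-semistable pairs the first two are [Castella 2024 Thm. 3.1 + §2.3] PRE); (REG) per pair; (TC) one twist certificate per split-only pair with `p ∤ ∏c` (54 755 ‖
3 291); (T2∗′) the conjecture `RelativeExceptionalLeadingTermAt` only on split-only pairs with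
`p ∣ ∏c` (334 ‖ 35); (T4′) the corner (64 ‖ 5). NO `h32`, NO semistability case split. Gen 22's
`P2.bsdp_of_onTree_cyclotomic_twistCertificate` with (T1) assembled from the frame form by
`P2.openInputOnTreeAt_of_imcDivFrame`. CONDITIONAL; nothing booked; labels UNCHANGED; X11b stays
CONSTRUCTION-SHAPED. [cite: Castella2018Erratum, (2.4) (p. 4)] [cite: Castella2018, Thms. 2.3, 3.1, 3.2]
[cite: McCallumLMS1991, §1 Theorem (Kolyvagin), p. 296] [cite: Disegni2020, Thm. 1 (§1.2), Thm. 4, (∗)]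
[cite: Wuthrich2014, Thm. 3 (p. 383), Prop. 21 (p. 400)] [cite: SteinWuthrich2013, Thm. 6.1, §4.2]
[cite: Miller2011LMS, Def. 1.1] -/
theorem P2.bsdp_of_onTree_frame
    -- route p2's published inputs
    (hGZ : ∀ (N : ℕ) [NeZero N] (W : WeierstrassCurve ℚ) (K : Type) [Field K] [NumberField K],
      gross_zagier N W K)
    (hKo : ∀ (N : ℕ) [NeZero N] (W : WeierstrassCurve ℚ) (K : Type) [Field K] [NumberField K],
      kolyvagin N W K)
    (hB : ∀ (N : ℕ) [NeZero N] (W : WeierstrassCurve ℚ) (K : Type) [Field K] [NumberField K],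
      Kolyvagin1990_padicValNat_card_sha_le N W K)
    (hWu : sha_dvd_analyticSha) (hGZK : rank_eq_analyticRank_of_analyticRank_le_one)
    (hnf : exists_isNewformOf) (hHL : HoffsteinLuo1997_exists_twist_L_one_ne_zero)
    (hMaz : mazur_not_dvd_maninConstant_of_odd) (hBDMTV : thm12_not_le_normalizer_splitCartan)
    (hPT : ∀ (K : Type) [Field K] [NumberField K], poitouTate_sum_localTatePairing_eq_zero K)
    (hEP : ∀ (K : Type) [Field K] [NumberField K] (v : HeightOneSpectrum (𝓞 K)),
      localEulerPoincareCharacteristic (v.adicCompletion K))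
    -- the lever's published inputs
    (hK : kato_charIdeal_dvd_multiplicative_of_surjective)
    (hJn : thm61_nonsplitMultiplicative) (hJs : thm61_splitMultiplicative)
    (hHn : exists_isMultCanonical) (hHs : exists_isSplitMultCanonical)
    (hD : thm1_padicBSD_rankOne_multiplicative) (hpar : nonempty_modularParametrizationData)
    -- THE ONE TYPED INPUT: the frame form (Cas18 3.1 ∧ 3.2 ∧ erratum (2.4), ∃∧), on every pair
    (hF : ∀ (W : WeierstrassCurve ℚ) [W.IsElliptic] [W.IsGloballyMinimal] (p : ℕ) [Fact p.Prime],
      ClassX11b W p → 5 ≤ p → P2.IMCDivFrameOnTree W p)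
    -- (REG)
    (hReg : ∀ (W : WeierstrassCurve ℚ) [W.IsElliptic] [W.IsGloballyMinimal] (p : ℕ) [Fact p.Prime],
      ClassX11b W p → 5 ≤ p → ClassClosure.RegulatorNonvanishingAt W p)
    -- (TC) ONE twist certificate per split-only pair with `p ∤ ∏c`
    (hTC : ∀ (W : WeierstrassCurve ℚ) [W.IsElliptic] [W.IsGloballyMinimal] (p : ℕ) [Fact p.Prime],
      ClassX11b W p → 5 ≤ p → W.HasSplitMultiplicativeReductionAtPrime p →
      (¬ ∃ (m : ℕ) (_ : Fact m.Prime), m ≠ p ∧ W.HasMultiplicativeReductionAtPrime m) →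
      ¬ p ∣ W.tamagawaProduct →
      ∃ (K : Type) (_ : Field K) (_ : NumberField K) (Wd : WeierstrassCurve ℚ) (_ : Wd.IsElliptic)
        (_ : Wd.IsGloballyMinimal) (Cd : VariableChange ℚ) (qd : ℚ),
        IsImaginaryQuadratic K ∧ SatisfiesHeegnerHypothesis (W.conductorNorm ℤ) K ∧
        NumberField.discr K < -4 ∧ Cd • W.quadraticTwist (NumberField.discr K : ℚ) = Wd ∧
        Wd.entireLFunction 1 / (Wd.realPeriodRat : ℂ) = (qd : ℂ) ∧ qd ≠ 0 ∧ padicValRat p qd = 0)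
    -- (T2∗′) the exceptional conjecture, only on split-only pairs with `p ∣ ∏c`
    (hC : ∀ (W : WeierstrassCurve ℚ) [W.IsElliptic] [W.IsGloballyMinimal] (p : ℕ) [Fact p.Prime],
      ClassX11b W p → 5 ≤ p → W.HasSplitMultiplicativeReductionAtPrime p →
      (¬ ∃ (m : ℕ) (_ : Fact m.Prime), m ≠ p ∧ W.HasMultiplicativeReductionAtPrime m) →
      p ∣ W.tamagawaProduct → ClassClosure.RelativeExceptionalLeadingTermAt W p)
    -- (T4′)
    (hCorner : ∀ (W : WeierstrassCurve ℚ) [W.IsElliptic] [W.IsGloballyMinimal] (p : ℕ)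
      [Fact p.Prime], ClassX11b W p → ¬ Surj W p → (p = 5 ∨ p = 7) →
        p ∣ padicValInt p W.minimalDiscriminantInt → ¬ Ram W p → Typed.MissingPPartAt W p)
    (W : WeierstrassCurve ℚ) [W.IsElliptic] [W.IsGloballyMinimal] (p : ℕ) [Fact p.Prime]
    (hX : ClassX11b W p) (hp5 : 5 ≤ p) : BSDp W p :=
  P2.bsdp_of_onTree_cyclotomic_twistCertificate hGZ hKo hB hWu hGZK
    (hasEntireLFunction_rat_of_exists_isNewformOf hnf) hnf hHL hMaz hBDMTV hPT hEP hK hJn hJs hHn hHs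
    hD hpar
    (fun W _ _ p _ N _ K _ _ Dt H ι P hX hp5 ↦
      P2.openInputOnTreeAt_of_imcDivFrame hnf hGZK hKo hPT hEP (hF W p hX hp5) N K Dt H ι P hX hp5)
    hReg hTC hC hCorner W p hX hp5

end Summit.BirchSwinnertonDyer.Rank1Residual.X11b

end
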